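import Literature.MathematicalPhysics.QuantumFieldTheory.Balaban1983to89.B6GOneLevelV1Bridge
import Literature.MathematicalPhysics.QuantumFieldTheory.Balaban1983to89.B5Prop12GHolds
import Literature.MathematicalPhysics.QuantumFieldTheory.Balaban1983to89.B5Cube1Partition
import Literature.MathematicalPhysics.QuantumFieldTheory.Balaban1983to89.B5G183FreeRowSum
import Summits.QuantumFields.YangMills.Theorems.UnitScaleTiltProp7FlatCoercivityR
import HarnessLib

/-!
# Route `UnitScaleTilt`, crux K1 child «MinimiserStabilityRegPr» (stmt-QuantumFields-19200), leaves V2′ (one-step halving, Sect. F) and V3 (Prop. 7):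
# **[Balaban1984PropagatorsI] PROP. 1.2 (1.110), THE GRADIENT AND LAPLACIAN ENTRIES `|∇GJ|, |ΔGJ| ≤ O(1)e^{−δ₀|y−y′|}|J|` FOR THE FLAT CONSTRAINED
# V1 PROPAGATOR `G = Δ_a⁻¹` OF [Balaban1984PropagatorsII] (2.19)/(2.90) IN THE SETUP TORUS'S OWN LETTERS (`Site.shift`/`unshift` differences with the
# lattice factor `L^j = η⁻¹`), every `Params`, any `a > 0`; instances at the d = 3 carrier**

Cell `ym3-torus` (HUMAN RULING D-0037, YM ladder rung R3), seat `ym3-torus-p1` gen 14 (UV side); memo HOME/UV3-NODE.md §23.  `--supports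
stmt-QuantumFields-19200 --as helper`.  Third file of the flat-propagator bridge (after `UnitScaleTiltProp8FlatPropagatorSup` — first entry, `a = 1`,
absolute constants — and `UnitScaleTiltProp8FlatPropagatorProp12` — the full Prop. 1.2 at `(P, j)` in b05's letters and the first entries for `GE`).
[Balaban1985Variational] Sect. F (163)–(164) use `|∇A₁|`, `|∂*∂A₁|`, `|ΔA₁|` of `A₁ = −G(…)` with FLAT operators (p. 302: *«all the operators in this
section are taken without any external gauge field configuration … These operators were considered in [2,3]»*); this file delivers the `∇G` and `ΔG`
entries of (1.110) for the one-level `G` READ AS DIFFERENCES OF THE V1 BOND FIELD `Gx` along the Setup torus.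
* §1 the dictionary: **`EK_shift`** / `EK_unshift` (`EK (s ± e_ν) = EK s ± e_ν`, p16's `eK_shift`/r03's `eK_unshift` through `towerE = recast`),
  `EK_symm_add_unitVec` / `EK_symm_sub_unitVec`, `shift_unshift`; **`grad_TV_apply`** (`(∇_ν ũ)_μ(EK s) = L^j(u⟨s+e_ν,μ⟩ − u⟨s,μ⟩)`, b05's
  `B5Prop11Lattice.grad` = `fdiff` with factor `n = L^j`) and **`Lap_TV_apply`** (`(Δũ)_μ(EK s) = (L^j)²Σ_ν[(u⟨s,μ⟩ − u⟨s+e_ν,μ⟩) + (u⟨s,μ⟩ − u⟨s−e_ν,μ⟩)]`,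
  b05's positive `B5Prop11Lower.Lap = Σ_ν ∇_ν^*∇_ν`) for `ũ = TV u`.
* §2 **`grad_lap_GE_le_of_ineq110`** — from the typed block `B5.Ineq110_114` of b05's real setting at `(L^j, Mk P j)`: `x` real, `|x| ≤ B`, supported on the
  bonds issuing from `B^j(y′)`, `s ∈ B^j(y)` ⇒ for every `μ`: (∇) `L^j·|(Gx)(⟨s+e_ν,μ⟩) − (Gx)(⟨s,μ⟩)| ≤ C e^{−δ₀|y−y′|}B` for all `ν`; (Δ)
  `(L^j)²·|Σ_ν[…]| ≤ C e^{−δ₀|y−y′|}B` (`|y−y′|` = `distSite` on `T^{(j)}`), via r03's `TV_GE_twoScale_empty` and §1.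
* §3 **`exists_GE_grad_lap_decay`** (every `Params`, constants before `P` given `d, L, a`, from lit-balaban's hypothesis-free `B5Prop12GHolds.prop12_famG_printed`
  at the member `⟨P.d, P.L, P.m + P.K − j, j⟩` of the family of record — definitionally `latticeSettingP12R (P.L^j) (Mk P j) a j`) and
  **`exists_GE_grad_lap_decay_T3`** (d = 3 carrier, `F.L = L`, `n < K`, `j = K − n`; uniform in `m, n, K`).
HONEST SCOPE.  (i) The `G∇*J` entry and the Hölder / `L²` entries are not re-read here (available in b05's letters from Prop. 1.2 at `(P, j)`);
(ii) `U = 1`, one level, print's `R`-constrained (2.19) operator, NOT the sharp-constraint `H`/`G₁`; (iii) constants lit-balaban's, functions of `(d, L, a)`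
(print: `d` only); (iv) `1 ≤ j`.  No definition, no sorry, standard axioms.  NOT a claim about the mass gap.

References: T. Bałaban, CMP **95** (1984) 17–40 [Balaban1984PropagatorsI] Prop. 1.2 (1.110) p.35, (1.21) p.21, (1.31) p.23; CMP **96** (1984) 223–250
[Balaban1984PropagatorsII] (2.19)/(2.22) p.226, (2.90) p.239; CMP **102** (1985) 277–309 [Balaban1985Variational] Sect. F (162)–(164) p.302.
-/

set_option autoImplicit false

noncomputable section

open scoped BigOperators InnerProductSpace Matrix ComplexConjugate

namespace Summit.QuantumFields.YangMills.Theorems.FlatPropagatorGrad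

open Literature.MathematicalPhysics.QuantumFieldTheory.Balaban1983to89
open Literature.MathematicalPhysics.QuantumFieldTheory.BalabanImbrieJaffe1984to88.BIJ85AxialPropagator411 (BondSpace)
open LatticeFieldCalculus B6SectADomainsV1 B6SectAOperatorsV1 B6SectAVectorModelV1 B6SectCTwoScaleV1 B6GOneLevelV1Bridge
open B5Eq117TorusCarriers (Mk EK eK eK_shift EK_blockSiteK blockSiteK blockEquivK)
open B5Eq147TorusBridge (eK_unshift)
open B5Eq118OneStroke (iterBlock)
open B5Prop11Plancherel (Tor fine unitVec fdiff)
open B5TowerOneStroke (towerE towerE_eq recast_unitVec)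
open B5Composition116 (recast recast_add)
open B5DeltaA169 (DeltaA)
open B5Block118 (bpt)
open B5Blocks16 (bpt_val)
open B5SettingP12Real (LocR latticeSettingP12R)
open B5Prop12FieldsLattice (distSite cube1 cubeT cubeB suppInL supNormL eL)
open B5Cube1Partition (mem_cube1_iff cube1_subset_cubeT)
open B5Prop11Lower (Lap)
open B5G183FreeRowSum (fdiff_mulVec fdiff_conjTranspose_mulVec)
open LatticeNorms (supNorm norm_le_supNorm supNorm_le)
open B5ResidualGpTorusHolds (TopIdx)
open B5Prop12GLattice (famG)
open B5Prop12GHolds (prop12_famG_printed)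

variable {P : Params} {j : ℕ}

/-! ## §1 Lattice steps under `EK` and the transported differences -/

/-- `EK (s + e_ν) = EK s + e_ν`: the one-stroke identification takes lattice steps to lattice steps (p16's `eK_shift`, `recast_add`/`recast_unitVec`).
[cite: Balaban1984PropagatorsI, (1.1) p.18, (1.18) p.20] -/
theorem EK_shift (hj : j ≤ P.m + P.K) (s : Site P 0) (ν : Fin P.d) :
    EK hj (s.shift ν) = EK hj s + unitVec (fine (P.L ^ j) (Mk P j)) ν := by
  show towerE P.L (Mk P j) j (eK hj (s.shift ν)) = towerE P.L (Mk P j) j (eK hj s) + _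
  rw [eK_shift, towerE_eq, recast_add, recast_unitVec]

/-- `(s − e_ν) + e_ν = s` on the Setup torus. [folklore] -/
theorem shift_unshift (s : Site P 0) (ν : Fin P.d) : (s.unshift ν).shift ν = s := by
  funext μ
  simp only [Site.shift, Site.unshift]
  by_cases h : μ = ν
  · subst h; simp
  · simp [Function.update_of_ne h]

/-- `EK (s − e_ν) = EK s − e_ν`. [cite: Balaban1984PropagatorsI, (1.21) p.21] -/
theorem EK_unshift (hj : j ≤ P.m + P.K) (s : Site P 0) (ν : Fin P.d) :
    EK hj (s.unshift ν) = EK hj s - unitVec (fine (P.L ^ j) (Mk P j)) ν := by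
  have h := EK_shift hj (s.unshift ν) ν
  rw [shift_unshift] at h
  rw [h, add_sub_cancel_right]

/-- `EK⁻¹ (z + e_ν) = (EK⁻¹ z) + e_ν`. [cite: Balaban1984PropagatorsI, (1.18) p.20] -/
theorem EK_symm_add_unitVec (hj : j ≤ P.m + P.K) (z : Tor (fine (P.L ^ j) (Mk P j))) (ν : Fin P.d) :
    (EK hj).symm (z + unitVec (fine (P.L ^ j) (Mk P j)) ν) = ((EK hj).symm z).shift ν := by
  rw [Equiv.symm_apply_eq, EK_shift, Equiv.apply_symm_apply]

/-- `EK⁻¹ (z − e_ν) = (EK⁻¹ z) − e_ν`. [cite: Balaban1984PropagatorsI, (1.21) p.21] -/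
theorem EK_symm_sub_unitVec (hj : j ≤ P.m + P.K) (z : Tor (fine (P.L ^ j) (Mk P j))) (ν : Fin P.d) :
    (EK hj).symm (z - unitVec (fine (P.L ^ j) (Mk P j)) ν) = ((EK hj).symm z).unshift ν := by
  rw [Equiv.symm_apply_eq, EK_unshift, Equiv.apply_symm_apply]

/-- **`∇_ν` OF A TRANSPORTED BOND FIELD IN V1 LETTERS**: `(∇_ν ũ)_μ(EK s) = L^j·(u(⟨s + e_ν, μ⟩) − u(⟨s, μ⟩))` — b05's `η`-scaled forward
difference (`B5Prop11Lattice.grad`, `η⁻¹ = L^j`) of `ũ = TV u` at a bond is the scaled V1 difference along `Site.shift`.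
[cite: Balaban1984PropagatorsI, (1.31) p.23, (1.21) p.21] -/
theorem grad_TV_apply (hj : j ≤ P.m + P.K) (u : BondSpace P) (ν : Fin P.d) (s : Site P 0) (μ : Fin P.d) :
    B5Prop11Lattice.grad (P.L ^ j) (Mk P j) (TV hj u) ν (EK hj s, μ)
      = ((((P.L : ℝ) ^ j * (u ⟨s.shift ν, μ⟩ - u ⟨s, μ⟩) : ℝ)) : ℂ) := by
  unfold B5Prop11Lattice.grad
  rw [fdiff_mulVec]
  simp only [TV_apply, EK_symm_add_unitVec, Equiv.symm_apply_apply]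
  push_cast
  ring

/-- **`Δ` OF A TRANSPORTED BOND FIELD IN V1 LETTERS**: b05's positive vector Laplacian `Δ = Σ_ν ∇_ν^*∇_ν` (`B5Prop11Lower.Lap`) of `ũ = TV u` at a bond:
`(Δũ)_μ(EK s) = (L^j)²·Σ_ν [(u(⟨s,μ⟩) − u(⟨s+e_ν,μ⟩)) + (u(⟨s,μ⟩) − u(⟨s−e_ν,μ⟩))]`. [cite: Balaban1984PropagatorsI, (1.21) p.21, (1.90) p.33] -/
theorem Lap_TV_apply (hj : j ≤ P.m + P.K) (u : BondSpace P) (s : Site P 0) (μ : Fin P.d) :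
    (Lap (P.L ^ j) (Mk P j) *ᵥ TV hj u) (EK hj s, μ)
      = ((((P.L : ℝ) ^ j) ^ 2 * ∑ ν : Fin P.d, ((u ⟨s, μ⟩ - u ⟨s.shift ν, μ⟩) + (u ⟨s, μ⟩ - u ⟨s.unshift ν, μ⟩)) : ℝ) : ℂ) := by
  have e : (Lap (P.L ^ j) (Mk P j) *ᵥ TV hj u) (EK hj s, μ)
      = ∑ ν, (((fdiff (fine (P.L ^ j) (Mk P j)) ((P.L ^ j : ℕ) : ℂ) ν)ᴴ * fdiff (fine (P.L ^ j) (Mk P j)) ((P.L ^ j : ℕ) : ℂ) ν)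
          *ᵥ TV hj u) (EK hj s, μ) := by
    rw [Lap, Matrix.sum_mulVec]
    simp only [Finset.sum_apply]
  have hν : ∀ ν : Fin P.d,
      (((fdiff (fine (P.L ^ j) (Mk P j)) ((P.L ^ j : ℕ) : ℂ) ν)ᴴ * fdiff (fine (P.L ^ j) (Mk P j)) ((P.L ^ j : ℕ) : ℂ) ν) *ᵥ TV hj u)
          (EK hj s, μ)
        = ((((P.L : ℝ) ^ j) ^ 2 * ((u ⟨s, μ⟩ - u ⟨s.shift ν, μ⟩) + (u ⟨s, μ⟩ - u ⟨s.unshift ν, μ⟩)) : ℝ) : ℂ) := by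
    intro ν
    rw [← Matrix.mulVec_mulVec, fdiff_conjTranspose_mulVec, fdiff_mulVec, fdiff_mulVec, map_natCast]
    simp only [sub_add_cancel, TV_apply, EK_symm_add_unitVec, EK_symm_sub_unitVec, Equiv.symm_apply_apply]
    push_cast
    ring
  rw [e, Finset.sum_congr rfl fun ν _ => hν ν]
  push_cast
  rw [Finset.mul_sum]

/-! ## §2 The gradient and Laplacian entries of (1.110) for `G = GE`, in V1 letters -/

/-- sites of `B^j(y)` are block points under `EK`. [cite: Balaban1984PropagatorsI, (1.18) p.20] -/
private theorem exists_EK_eq_bpt'' (hj : j ≤ P.m + P.K) {y : Site P j} {x : Site P 0} (hx : x ∈ iterBlock j y) :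
    ∃ r : Fin P.d → Fin (P.L ^ j), EK hj x = bpt (P.L ^ j) (Mk P j) y r := by
  refine ⟨(blockEquivK hj y).symm ⟨x, hx⟩, ?_⟩
  have h : blockSiteK j y ((blockEquivK hj y).symm ⟨x, hx⟩) = x :=
    congrArg Subtype.val ((blockEquivK hj y).apply_symm_apply ⟨x, hx⟩)
  rw [← EK_blockSiteK hj, h]

/-- block points lie in b05's unit cube `Δ(y)`. [cite: Balaban1984PropagatorsI, p.35] -/
private theorem bpt_mem_cube1' {d : ℕ} (n : ℕ) [NeZero n] (M : Fin d → ℕ) [∀ μ, NeZero (M μ)] (hn : 1 ≤ n)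
    (y : Tor M) (r : Fin d → Fin n) : bpt n M y r ∈ cube1 n M y := by
  rw [mem_cube1_iff]
  funext μ
  show (((bpt n M y r μ).val / n : ℕ) : ZMod (M μ)) = y μ
  rw [bpt_val, Nat.mul_add_div (by omega), Nat.div_eq_of_lt (r μ).isLt, add_zero, ZMod.natCast_zmod_val]

/-- `B^j(y) ⊂ Δ̃(y)` under `EK`. [cite: Balaban1984PropagatorsI, p.35] -/
private theorem EK_mem_cubeT' (hj : j ≤ P.m + P.K) {y : Site P j} {x : Site P 0} (hx : x ∈ iterBlock j y) :
    EK hj x ∈ cubeT (P.L ^ j) (Mk P j) y := by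
  obtain ⟨r, hr⟩ := exists_EK_eq_bpt'' hj hx
  rw [hr]
  have hn : 1 ≤ P.L ^ j := Nat.one_le_pow _ _ P.L_pos
  exact cube1_subset_cubeT (Mk P j) (P.L ^ j) hn y (bpt_mem_cube1' (P.L ^ j) (Mk P j) hn y r)

/-- **[Balaban1984PropagatorsI] (1.110), GRADIENT AND LAPLACIAN ENTRIES, FOR THE V1 PROPAGATOR IN V1 LETTERS** — from the typed Prop. 1.2 block
`B5.Ineq110_114` of b05's real setting at `(L^j, Mk P j)` (any `a > 0`): for the one-level structure with lattice factor `L^j` and weight `a·(L^j)^d`,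
a real bond field `x` with `|x| ≤ B` supported on the bonds issuing from `B^j(y′)`, and a bond `b = ⟨s, μ⟩` with `s ∈ B^j(y)`:
(∇) for every direction `ν`, `L^j·|(Gx)(⟨s+e_ν, μ⟩) − (Gx)(⟨s, μ⟩)| ≤ C·e^{−δ₀|y−y′|}·B` («|(∇GJ)(x)|»);
(Δ) `(L^j)²·|Σ_ν [(Gx)(b) − (Gx)(⟨s+e_ν,μ⟩) + (Gx)(b) − (Gx)(⟨s−e_ν,μ⟩)]| ≤ C·e^{−δ₀|y−y′|}·B` («|(ΔGJ)(x)|», positive Laplacian `Σ_ν∇_ν^*∇_ν`).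
[cite: Balaban1984PropagatorsI, Prop. 1.2 (1.110) p.35; Balaban1984PropagatorsII, (2.22) p.226] -/
theorem grad_lap_GE_le_of_ineq110 (hj1 : j + 1 ≤ P.m + P.K) {a : ℝ} (ha : 0 < a)
    {C δ₀ : ℝ} (hC : 0 ≤ C) {Cα Cε : ℝ → ℝ} {Cαε : ℝ → ℝ → ℝ}
    (hI : B5.Ineq110_114 (latticeSettingP12R (P.L ^ j) (Mk P j) a j) C Cα Cε Cαε δ₀)
    {w : BondIdx (twoScale j hj1 (∅ : Finset (Site P (j + 1)))) → ℝ}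
    (hw : ∀ i, 0 < w i) (hwa : ∀ p, w p = a * ((P.L : ℝ) ^ j) ^ P.d) (x : BondSpace P) {B : ℝ} (hxB : ∀ b', |x b'| ≤ B)
    (y y' : Site P j) (hsupp : ∀ b', x b' ≠ 0 → b'.src ∈ iterBlock j y')
    (s : Site P 0) (hs : s ∈ iterBlock j y) (μ : Fin P.d) :
    (∀ ν : Fin P.d,
      (P.L : ℝ) ^ j * |GE (twoScale j hj1 ∅) (c := (P.L : ℝ) ^ j) (pow_ne_zero j (Nat.cast_ne_zero.2 P.L_pos.ne')) hw x ⟨s.shift ν, μ⟩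
          - GE (twoScale j hj1 ∅) (c := (P.L : ℝ) ^ j) (pow_ne_zero j (Nat.cast_ne_zero.2 P.L_pos.ne')) hw x ⟨s, μ⟩|
        ≤ C * Real.exp (-(δ₀ * distSite (Mk P j) y y')) * B) ∧
    ((P.L : ℝ) ^ j) ^ 2 * |∑ ν : Fin P.d,
        ((GE (twoScale j hj1 ∅) (c := (P.L : ℝ) ^ j) (pow_ne_zero j (Nat.cast_ne_zero.2 P.L_pos.ne')) hw x ⟨s, μ⟩
            - GE (twoScale j hj1 ∅) (c := (P.L : ℝ) ^ j) (pow_ne_zero j (Nat.cast_ne_zero.2 P.L_pos.ne')) hw x ⟨s.shift ν, μ⟩)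
          + (GE (twoScale j hj1 ∅) (c := (P.L : ℝ) ^ j) (pow_ne_zero j (Nat.cast_ne_zero.2 P.L_pos.ne')) hw x ⟨s, μ⟩
            - GE (twoScale j hj1 ∅) (c := (P.L : ℝ) ^ j) (pow_ne_zero j (Nat.cast_ne_zero.2 P.L_pos.ne')) hw x ⟨s.unshift ν, μ⟩))|
      ≤ C * Real.exp (-(δ₀ * distSite (Mk P j) y y')) * B := by
  have hj : j ≤ P.m + P.K := Nat.le_of_succ_le hj1
  have hB : 0 ≤ B := (abs_nonneg _).trans (hxB ⟨s, μ⟩)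
  have hLj : 0 ≤ (P.L : ℝ) ^ j := by positivity
  set Jr : Tor (fine (P.L ^ j) (Mk P j)) × Fin P.d → ℝ := fun i => x ⟨(EK hj).symm i.1, i.2⟩ with hJr
  have hemb : (LocR.vec Jr).emb = .vec (TV hj x) := by
    rw [TV_eq_cplx]
    rfl
  have hsuppJ : (latticeSettingP12R (P.L ^ j) (Mk P j) a j).suppIn (LocR.vec Jr) y' := by
    show suppInL (P.L ^ j) (Mk P j) (LocR.vec Jr).emb y'
    rw [hemb]
    rintro ⟨z, κ⟩ hz
    rw [TV_apply, Ne, Complex.ofReal_eq_zero] at hz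
    have hmem := hsupp ⟨(EK hj).symm z, κ⟩ hz
    have := EK_mem_cubeT' hj hmem
    rwa [Equiv.apply_symm_apply] at this
  have hsup : (latticeSettingP12R (P.L ^ j) (Mk P j) a j).supNorm (LocR.vec Jr) ≤ B := by
    show supNormL (P.L ^ j) (Mk P j) (LocR.vec Jr).emb ≤ B
    rw [hemb]
    show supNorm Finset.univ (TV hj x) ≤ B
    refine supNorm_le hB fun i _ => ?_
    obtain ⟨z, κ⟩ := i
    rw [TV_apply, Complex.norm_real, Real.norm_eq_abs]
    exact hxB _
  have hrhs : C * Real.exp (-(δ₀ * distSite (Mk P j) y y')) * (latticeSettingP12R (P.L ^ j) (Mk P j) a j).supNorm (LocR.vec Jr)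
      ≤ C * Real.exp (-(δ₀ * distSite (Mk P j) y y')) * B :=
    mul_le_mul_of_nonneg_left hsup (mul_nonneg hC (Real.exp_pos _).le)
  have hmemB : (EK hj s, μ) ∈ cubeB (P.L ^ j) (Mk P j) y :=
    Finset.mem_product.2 ⟨EK_mem_cubeT' hj hs, Finset.mem_univ _⟩
  -- the transported propagator
  have hT := TV_GE_twoScale_empty hj1 hw ha hwa x
  constructor
  · intro ν
    have h := hI.1 1 (LocR.vec Jr) y y' hsuppJ
    have he : (latticeSettingP12R (P.L ^ j) (Mk P j) a j).e 1 (LocR.vec Jr) y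
        = supNorm (Finset.univ ×ˢ cubeB (P.L ^ j) (Mk P j) y)
            (fun p : Fin P.d × (Tor (fine (P.L ^ j) (Mk P j)) × Fin P.d) =>
              B5Prop11Lattice.grad (P.L ^ j) (Mk P j) ((DeltaA (P.L ^ j) (Mk P j) a)⁻¹ *ᵥ TV hj x) p.1 p.2) := by
      show eL (P.L ^ j) (Mk P j) a 1 (LocR.vec Jr).emb y = _
      rw [hemb]
      rfl
    rw [he, ← hT] at h
    have hmem' : (ν, (EK hj s, μ)) ∈ Finset.univ ×ˢ cubeB (P.L ^ j) (Mk P j) y :=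
      Finset.mem_product.2 ⟨Finset.mem_univ ν, hmemB⟩
    have hval := norm_le_supNorm
      (fun p : Fin P.d × (Tor (fine (P.L ^ j) (Mk P j)) × Fin P.d) =>
        B5Prop11Lattice.grad (P.L ^ j) (Mk P j) (TV hj (GE (twoScale j hj1 ∅) (c := (P.L : ℝ) ^ j)
          (pow_ne_zero j (Nat.cast_ne_zero.2 P.L_pos.ne')) hw x)) p.1 p.2) hmem'
    dsimp only at hval
    rw [grad_TV_apply, Complex.norm_real, Real.norm_eq_abs, abs_mul, abs_of_nonneg hLj] at hval
    exact hval.trans (h.trans hrhs)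
  · have h := hI.1 3 (LocR.vec Jr) y y' hsuppJ
    have he : (latticeSettingP12R (P.L ^ j) (Mk P j) a j).e 3 (LocR.vec Jr) y
        = supNorm (cubeB (P.L ^ j) (Mk P j) y) (Lap (P.L ^ j) (Mk P j) *ᵥ ((DeltaA (P.L ^ j) (Mk P j) a)⁻¹ *ᵥ TV hj x)) := by
      show eL (P.L ^ j) (Mk P j) a 3 (LocR.vec Jr).emb y = _
      rw [hemb]
      rfl
    rw [he, ← hT] at h
    have hval := norm_le_supNorm
      (Lap (P.L ^ j) (Mk P j) *ᵥ TV hj (GE (twoScale j hj1 ∅) (c := (P.L : ℝ) ^ j)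
          (pow_ne_zero j (Nat.cast_ne_zero.2 P.L_pos.ne')) hw x)) hmemB
    rw [Lap_TV_apply, Complex.norm_real, Real.norm_eq_abs, abs_mul, abs_of_nonneg (sq_nonneg _)] at hval
    exact hval.trans (h.trans hrhs)

/-! ## §3 Packaged: every `Params`, and the d = 3 carrier -/

/-- **PACKAGED, EVERY `Params`** (the gradient and Laplacian entries of (1.110) in V1 letters): for `d ≥ 1`, odd `L > 1`, `a > 0` there are
`C, δ₀ > 0` (functions of `d, L, a`) such that for every `P` with `P.d = d`, `P.L = L`, every `1 ≤ j`, `j + 1 ≤ m + K`, weights `a·(L^j)^d`,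
every real bond field `x` with `|x| ≤ B` supported on the bonds issuing from `B^j(y′)` and every `s ∈ B^j(y)`, `μ`:
`L^j·|(Gx)(⟨s+e_ν,μ⟩) − (Gx)(⟨s,μ⟩)| ≤ C e^{−δ₀|y−y′|} B` for all `ν`, and `(L^j)²·|(ΔGx)_μ(s)| ≤ C e^{−δ₀|y−y′|} B` (lit-balaban's
hypothesis-free `B5Prop12GHolds.prop12_famG_printed`, re-indexed at the member `⟨P.d, P.L, P.m+P.K−j, j⟩` of the family of record).
[cite: Balaban1984PropagatorsI, Prop. 1.2 (1.110) p.35] -/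
theorem exists_GE_grad_lap_decay (d L : ℕ) (hd : 1 ≤ d) (hL : Odd L ∧ 1 < L) {a : ℝ} (ha : 0 < a) :
    ∃ C δ₀ : ℝ, 0 < C ∧ 0 < δ₀ ∧ ∀ (P : Params), P.d = d → P.L = L → ∀ (j : ℕ), 1 ≤ j → ∀ (hj1 : j + 1 ≤ P.m + P.K)
      (w : BondIdx (twoScale j hj1 (∅ : Finset (Site P (j + 1)))) → ℝ) (hw : ∀ i, 0 < w i),
      (∀ p, w p = a * ((P.L : ℝ) ^ j) ^ P.d) → ∀ (x : BondSpace P) (B : ℝ), (∀ b', |x b'| ≤ B) →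
        ∀ (y y' : Site P j), (∀ b', x b' ≠ 0 → b'.src ∈ iterBlock j y') → ∀ (s : Site P 0), s ∈ iterBlock j y → ∀ μ : Fin P.d,
          (∀ ν : Fin P.d,
            (P.L : ℝ) ^ j * |GE (twoScale j hj1 ∅) (c := (P.L : ℝ) ^ j) (pow_ne_zero j (Nat.cast_ne_zero.2 P.L_pos.ne')) hw x ⟨s.shift ν, μ⟩
                - GE (twoScale j hj1 ∅) (c := (P.L : ℝ) ^ j) (pow_ne_zero j (Nat.cast_ne_zero.2 P.L_pos.ne')) hw x ⟨s, μ⟩|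
              ≤ C * Real.exp (-(δ₀ * distSite (Mk P j) y y')) * B) ∧
          ((P.L : ℝ) ^ j) ^ 2 * |∑ ν : Fin P.d,
              ((GE (twoScale j hj1 ∅) (c := (P.L : ℝ) ^ j) (pow_ne_zero j (Nat.cast_ne_zero.2 P.L_pos.ne')) hw x ⟨s, μ⟩
                  - GE (twoScale j hj1 ∅) (c := (P.L : ℝ) ^ j) (pow_ne_zero j (Nat.cast_ne_zero.2 P.L_pos.ne')) hw x ⟨s.shift ν, μ⟩)
                + (GE (twoScale j hj1 ∅) (c := (P.L : ℝ) ^ j) (pow_ne_zero j (Nat.cast_ne_zero.2 P.L_pos.ne')) hw x ⟨s, μ⟩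
                  - GE (twoScale j hj1 ∅) (c := (P.L : ℝ) ^ j) (pow_ne_zero j (Nat.cast_ne_zero.2 P.L_pos.ne')) hw x ⟨s.unshift ν, μ⟩))|
            ≤ C * Real.exp (-(δ₀ * distSite (Mk P j) y y')) * B := by
  obtain ⟨δ₀, C, Cα, Cε, Cαε, hδ, hC, h110⟩ := prop12_famG_printed hd hL ha
  refine ⟨C, δ₀, hC, hδ, fun P hPd hPL j hj hj1 w hw hwa x B hxB y y' hsupp s hs μ => ?_⟩
  have hI : B5.Ineq110_114 (latticeSettingP12R (P.L ^ j) (Mk P j) a j) C Cα Cε Cαε δ₀ :=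
    h110 ⟨⟨P.d, P.L, P.m + P.K - j, j, P.hd, P.hL⟩, hPd, hPL, hj⟩
  exact grad_lap_GE_le_of_ineq110 hj1 ha hC.le hI hw hwa x hxB y y' hsupp s hs μ

section T3

open T3ContinuumYM3Torus (T3Family)
open Prop7FlatCoercivityR (succ_le_T3)

/-- **AT THE d = 3 CARRIER** (`F.L = L`, `n < K`, `j = K − n`, weight `a·(L^{K−n})³`): the gradient and Laplacian entries of (1.110) for the
one-level V1 propagator in V1 letters, with `C, δ₀` depending on `L, a` only (uniform in `m`, `n`, `K`) — the flat `|∇GJ|`, `|ΔGJ|` input of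
[Balaban1985Variational] Sect. F (163)–(164) at `U₀ = 1`. [cite: Balaban1984PropagatorsI, Prop. 1.2 (1.110) p.35; Balaban1985Variational, Sect. F (162)-(164) p.302] -/
theorem exists_GE_grad_lap_decay_T3 (L : ℕ) (hL : Odd L ∧ 1 < L) {a : ℝ} (ha : 0 < a) :
    ∃ C δ₀ : ℝ, 0 < C ∧ 0 < δ₀ ∧ ∀ (F : T3Family), F.L = L → ∀ (n K : ℕ), n < K →
      ∀ (w : BondIdx (twoScale (K - n) (succ_le_T3 F n K) (∅ : Finset (Site (F.P K) (K - n + 1)))) → ℝ) (hw : ∀ i, 0 < w i),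
      (∀ p, w p = a * ((F.L : ℝ) ^ (K - n)) ^ 3) → ∀ (x : BondSpace (F.P K)) (B : ℝ), (∀ b', |x b'| ≤ B) →
        ∀ (y y' : Site (F.P K) (K - n)), (∀ b', x b' ≠ 0 → b'.src ∈ iterBlock (K - n) y') →
          ∀ (s : Site (F.P K) 0), s ∈ iterBlock (K - n) y → ∀ μ : Fin 3,
          (∀ ν : Fin 3,
            (F.L : ℝ) ^ (K - n) *
              |GE (twoScale (K - n) (succ_le_T3 F n K) ∅) (c := ((F.L : ℝ)) ^ (K - n))
                  (pow_ne_zero (K - n) (Nat.cast_ne_zero.2 (F.P K).L_pos.ne')) hw x ⟨s.shift ν, μ⟩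
                - GE (twoScale (K - n) (succ_le_T3 F n K) ∅) (c := ((F.L : ℝ)) ^ (K - n))
                  (pow_ne_zero (K - n) (Nat.cast_ne_zero.2 (F.P K).L_pos.ne')) hw x ⟨s, μ⟩|
              ≤ C * Real.exp (-(δ₀ * distSite (Mk (F.P K) (K - n)) y y')) * B) ∧
          ((F.L : ℝ) ^ (K - n)) ^ 2 * |∑ ν : Fin 3,
              ((GE (twoScale (K - n) (succ_le_T3 F n K) ∅) (c := ((F.L : ℝ)) ^ (K - n))
                  (pow_ne_zero (K - n) (Nat.cast_ne_zero.2 (F.P K).L_pos.ne')) hw x ⟨s, μ⟩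
                - GE (twoScale (K - n) (succ_le_T3 F n K) ∅) (c := ((F.L : ℝ)) ^ (K - n))
                  (pow_ne_zero (K - n) (Nat.cast_ne_zero.2 (F.P K).L_pos.ne')) hw x ⟨s.shift ν, μ⟩)
              + (GE (twoScale (K - n) (succ_le_T3 F n K) ∅) (c := ((F.L : ℝ)) ^ (K - n))
                  (pow_ne_zero (K - n) (Nat.cast_ne_zero.2 (F.P K).L_pos.ne')) hw x ⟨s, μ⟩
                - GE (twoScale (K - n) (succ_le_T3 F n K) ∅) (c := ((F.L : ℝ)) ^ (K - n))
                  (pow_ne_zero (K - n) (Nat.cast_ne_zero.2 (F.P K).L_pos.ne')) hw x ⟨s.unshift ν, μ⟩))|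
            ≤ C * Real.exp (-(δ₀ * distSite (Mk (F.P K) (K - n)) y y')) * B := by
  obtain ⟨C, δ₀, hC, hδ, h⟩ := exists_GE_grad_lap_decay 3 L (by norm_num) hL ha
  refine ⟨C, δ₀, hC, hδ, fun F hFL n K hnK w hw hwa x B hxB y y' hsupp s hs μ => ?_⟩
  exact h (F.P K) rfl hFL (K - n) (by omega) (succ_le_T3 F n K) w hw hwa x B hxB y y' hsupp s hs μ

end T3

end Summit.QuantumFields.YangMills.Theorems.FlatPropagatorGrad

end
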